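import Mathlib
import HarnessLib
import Literature.Probability.Entropy.BretagnolleHuber
import Literature.Probability.MarkovChains.ProductChains

/-!
# Le Cam's sandwich `1 − B ≤ TV ≤ √(1 − B²)` and the tensorization of the Bhattacharyya coefficient

[cite: PolyanskiyWu2024, §7.3 eq. (7.22); Remark 7.7 eq. (7.26); eqs. (7.23)–(7.25)]

A sibling of `Entropy/BretagnolleHuber.lean` (which has `bhattacharyyaCoeff`, `TV = 1 − Σ min` and the
upper half `B² + TV² ≤ 1` of Le Cam's bound) and of `Entropy/DivergenceTensorization.lean` (KL / `χ²` /
TV under products, which defers the Hellinger part to here).  PROVED (0 named facts, no definition):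

* `one_sub_bhattacharyyaCoeff_le_tvDist`, `PolyanskiyWu2024_eq_7_22` — "(7.22)": `½H²(P,Q) ≤ TV(P,Q)
  ≤ H√(1 − H²/4)`, i.e. with `H² = 2 − 2B`: `1 − B ≤ TV ≤ √(1 − B²)` [cite: PolyanskiyWu2024, §7.3
  eq. (7.22)] (lower half from `min(p,q) ≤ √(pq)`);
* `bhattacharyyaCoeff_tensorFun` — "(7.26)": `H²(Π P_i, Π Q_i) = 2 − 2Π(1 − ½H²(P_i,Q_i))`, i.e.
  `B(⊗P_j, ⊗Q_j) = Π_j B(P_j, Q_j)` on the tree's `tensorFun` [cite: PolyanskiyWu2024, §7.3 Remark 7.7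
  eq. (7.26)];
* `tvDist_tensorFun_bhattacharyya_bounds`, `tvDist_tensorFun_const_bhattacharyya_bounds` — the
  product-law sandwich `1 − Π B_j ≤ TV(⊗P,⊗Q) ≤ √(1 − Π B_j²)` and its i.i.d. case
  `1 − B^n ≤ TV(P^{⊗n},Q^{⊗n}) ≤ √(1 − B^{2n})` — the computation behind "(7.23)–(7.25)"
  [cite: PolyanskiyWu2024, §7.3] ("TV(P_n^{⊗n},Q_n^{⊗n}) → 0 iff H²(P_n,Q_n) = o(1/n) … → 1 iff ω(1/n)").

Context (cell pub-lqcd): the exact exponential rate at which two product (factorised) laws become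
perfectly distinguishable with the volume — the Bhattacharyya coefficient per site.
-/

namespace Literature.Probability.Entropy

open Finset Real
open Literature.Probability.MarkovChains

variable {X : Type*} [Fintype X]

/-! ## Le Cam's lower bound `½H² ≤ TV` and the tensorization of the Bhattacharyya coefficient
-/

/-- **(7.22), lower half**: `½H²(P,Q) ≤ TV(P,Q)`, i.e. `1 − B(P,Q) ≤ TV(P,Q)` for two laws (non-negative,
mass one) — from `min(p,q) ≤ √(pq)` and `TV = 1 − Σ min`. [cite: PolyanskiyWu2024, §7.3 eq. (7.22)] -/
theorem one_sub_bhattacharyyaCoeff_le_tvDist {P Q : X → ℝ} (hP0 : ∀ x, 0 ≤ P x) (hQ0 : ∀ x, 0 ≤ Q x)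
    (hP1 : ∑ x, P x = 1) (hQ1 : ∑ x, Q x = 1) : 1 - bhattacharyyaCoeff P Q ≤ tvDist P Q := by
  rw [tvDist_eq_one_sub_sum_min hP1 hQ1]
  have h : ∑ x, min (P x) (Q x) ≤ bhattacharyyaCoeff P Q := by
    unfold bhattacharyyaCoeff
    refine sum_le_sum fun x _ => Real.le_sqrt_of_sq_le ?_
    rcases le_total (P x) (Q x) with hle | hle
    · rw [min_eq_left hle]; nlinarith [hP0 x]
    · rw [min_eq_right hle]; nlinarith [hQ0 x]
  linarith

/-- **Le Cam's sandwich (7.22)** for two laws: `1 − B ≤ TV ≤ √(1 − B²)`.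
[cite: PolyanskiyWu2024, §7.3 eq. (7.22)] -/
theorem PolyanskiyWu2024_eq_7_22 {P Q : X → ℝ} (hP0 : ∀ x, 0 ≤ P x) (hQ0 : ∀ x, 0 ≤ Q x)
    (hP1 : ∑ x, P x = 1) (hQ1 : ∑ x, Q x = 1) :
    1 - bhattacharyyaCoeff P Q ≤ tvDist P Q
      ∧ tvDist P Q ≤ Real.sqrt (1 - bhattacharyyaCoeff P Q ^ 2) :=
  ⟨one_sub_bhattacharyyaCoeff_le_tvDist hP0 hQ0 hP1 hQ1,
    Real.le_sqrt_of_sq_le (by linarith [sq_bhattacharyyaCoeff_add_sq_tvDist_le_one hP0 hQ0 hP1 hQ1])⟩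

section Product

variable {d : ℕ} {Y : Fin d → Type*} [∀ j, Fintype (Y j)]

/-- **Tensorization of the Bhattacharyya coefficient** [cite: PolyanskiyWu2024, §7.3 Remark 7.7
eq. (7.26)] ("`H²(Π P_i, Π Q_i) = 2 − 2 Π (1 − ½H²(P_i,Q_i))`", i.e. `B(⊗P, ⊗Q) = Π_j B(P_j, Q_j)`), for
non-negative factors, on the tree's product laws `tensorFun` (`MarkovChains/ProductChains.lean`). -/
theorem bhattacharyyaCoeff_tensorFun (P Q : ∀ j, Y j → ℝ) (hP0 : ∀ j u, 0 ≤ P j u)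
    (hQ0 : ∀ j u, 0 ≤ Q j u) :
    bhattacharyyaCoeff (tensorFun P) (tensorFun Q) = ∏ j, bhattacharyyaCoeff (P j) (Q j) := by
  unfold bhattacharyyaCoeff
  have hpt : ∀ x : ∀ j, Y j, Real.sqrt (tensorFun P x * tensorFun Q x)
      = tensorFun (fun j u => Real.sqrt (P j u * Q j u)) x := by
    intro x
    rw [tensorFun_mul]
    unfold tensorFun
    have hsq : (∏ j, Real.sqrt (P j (x j) * Q j (x j))) ^ 2 = ∏ j, P j (x j) * Q j (x j) := by
      rw [← prod_pow]
      exact prod_congr rfl fun j _ => Real.sq_sqrt (mul_nonneg (hP0 j (x j)) (hQ0 j (x j)))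
    rw [← hsq, Real.sqrt_sq (prod_nonneg fun j _ => Real.sqrt_nonneg _)]
  simp_rw [hpt]
  exact sum_tensorFun _

/-- **(7.22) with (7.26) for product laws** [cite: PolyanskiyWu2024, §7.3 (eq. (7.22), Remark 7.7
eq. (7.26); the computation proving (7.23)–(7.24))]:
`1 − Π_j B(P_j,Q_j) ≤ TV(⊗P_j, ⊗Q_j) ≤ √(1 − (Π_j B(P_j,Q_j))²)` — total variation between product laws
tends to `1` exponentially unless the factors' affinities tend to `1`. -/
theorem tvDist_tensorFun_bhattacharyya_bounds (P Q : ∀ j, Y j → ℝ) (hP0 : ∀ j u, 0 ≤ P j u)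
    (hQ0 : ∀ j u, 0 ≤ Q j u) (hP1 : ∀ j, ∑ u, P j u = 1) (hQ1 : ∀ j, ∑ u, Q j u = 1) :
    1 - ∏ j, bhattacharyyaCoeff (P j) (Q j) ≤ tvDist (tensorFun P) (tensorFun Q)
      ∧ tvDist (tensorFun P) (tensorFun Q)
          ≤ Real.sqrt (1 - (∏ j, bhattacharyyaCoeff (P j) (Q j)) ^ 2) := by
  rw [← bhattacharyyaCoeff_tensorFun P Q hP0 hQ0]
  exact PolyanskiyWu2024_eq_7_22 (fun x => prod_nonneg fun j _ => hP0 j (x j))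
    (fun x => prod_nonneg fun j _ => hQ0 j (x j)) (sum_tensorFun_eq_one P hP1)
    (sum_tensorFun_eq_one Q hQ1)

/-- The i.i.d. case: `1 − B(P,Q)^n ≤ TV(P^{⊗n}, Q^{⊗n}) ≤ √(1 − B(P,Q)^{2n})`.
[cite: PolyanskiyWu2024, §7.3 (eq. (7.25) and the display before Remark 7.7)] -/
theorem tvDist_tensorFun_const_bhattacharyya_bounds {Z : Type*} [Fintype Z] (n : ℕ) {P Q : Z → ℝ}
    (hP0 : ∀ z, 0 ≤ P z) (hQ0 : ∀ z, 0 ≤ Q z) (hP1 : ∑ z, P z = 1) (hQ1 : ∑ z, Q z = 1) :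
    1 - bhattacharyyaCoeff P Q ^ n ≤ tvDist (tensorFun fun _ : Fin n => P) (tensorFun fun _ : Fin n => Q)
      ∧ tvDist (tensorFun fun _ : Fin n => P) (tensorFun fun _ : Fin n => Q)
          ≤ Real.sqrt (1 - bhattacharyyaCoeff P Q ^ (2 * n)) := by
  have h := tvDist_tensorFun_bhattacharyya_bounds (fun _ : Fin n => P) (fun _ => Q) (fun _ => hP0)
    (fun _ => hQ0) (fun _ => hP1) fun _ => hQ1
  rw [prod_const, card_univ, Fintype.card_fin, ← pow_mul, mul_comm] at h
  exact h

end Product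

end Literature.Probability.Entropy
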